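import Literature.AnabelianGeometry.EtaleTheta.CyclotomeTowerAllLevels
import Literature.AnabelianGeometry.EtaleTheta.CyclotomeZHatEquiv
import HarnessLib

/-!
# [EtTh] §2 over §1: the cyclotome identifications `μ_N ≅ (l·Δ_Θ) ⊗ ℤ/Nℤ` (all `N`) and a compatible
# `CyclotomeTower` EXIST as soon as `Δ_Θ ≅ Ẑ(1)` is given as a GALOIS MODULE (a Tate-twist datum)

Mochizuki, *The Étale Theta Function …* [EtTh], Publ. RIMS **45** (2009), PRIMS PDF pages: §1 p. 12
«Let us denote the image of `∧² Δ^ell_X` in `Δ^Θ_X` by (`Ẑ(1) ≅`) `Δ_Θ`»; §2 p. 46 «the natural isomorphism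
`μ_N ≅ (l·Δ_Θ) ⊗ (ℤ/Nℤ)`»; Def. 2.13 (ii) p. 48 / Cor. 2.19 (ii) p. 64 (the compatible system over all levels).
Cell abc-iut, layer L2, seat abc-iut-L2-t8 (owner of `ThetaCyclotomes.lean` / `TowerOfSetting.lean`: the
INTERFACE structures `ThetaSetting.CyclotomeMod l N`, `ThetaSetting.CyclotomeTower l E`), R78 row #5
(«t8 adapter layer at the χ-twisted model», L2-lead R116) and GAP-LEDGER row **G-L2t10-1** («DATUM wanted:
`Nonempty (D.CyclotomeTower l E)` … a `G_K`-EQUIVARIANT, continuous identification `(l·Δ_Θ) ⊗ ℤ/Mℤ ≅ μ_M`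
at every level, compatible with the power maps»).

PROOF-ONLY (0 definitions).  For ANY theta setting `D` (abc-iut-L2-t1's `ThetaSetting`), ANY `l ≥ 1`, and a
**Tate-twist datum** on `Δ_Θ` in the shape the R78 file map produces (F5 `Δ_Θ(curveχ) ≃ₜ* Ẑ(χ)`, F3 `chi`):

* `e : Δ_Θ →* Ẑ` continuous and bijective (`Ẑ` = Mathlib's `ProfiniteGrp.ProfiniteCompletion.completion
  (GrpCat.of (Multiplicative ℤ))` = the tree's `SemiGraphs.ZHat`), and
* `χ : G_{ℚ_p} →* Aut(Ẑ) = Ẑ^×` which IS the cyclotomic character on roots of unity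
  (`hχ : σ ζ = ζ ^ χ_N(σ)` for `ζ ∈ μ_N(ℚ̄_p)`, `χ_N = ZHatLevel.levelChar N ∘ χ` — abc-iut-w5-d091's F3
  `SettingModel.apply_eq_pow_levelChar_chi` discharges it for THE character `SettingModel.chi p`), such that
* `hequiv : e (g d g⁻¹) = χ(aug g) · e d` — conjugation by `Π^tp_X` on `Δ_Θ` IS the cyclotomic character
  through `Π^tp_X ↠ G_K ⊆ G_{ℚ_p}` («`Δ_Θ ≅ Ẑ(1)`» as a Galois module),

we PROVE (v2 adds the INVERSE parametrisation `f : Ẑ ⥲ Δ_Θ`, `g f(t) g⁻¹ = f(χ(aug g) t)`, `Δ_Θ`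
Hausdorff: `exists_cyclotomeMod_family_of_tateTwist_inv`, `nonempty_cyclotomeTower_of_tateTwist_inv`):
`exists_cyclotomeMod_family_of_tateTwist` — a family `mods N : D.CyclotomeMod l N` for ALL
`N ≥ 1`, compatible with every power map `μ_{M'} ↠ μ_M` (`M ∣ M'`); hence `nonempty_cyclotomeMod_of_tateTwist`
(every level) and `nonempty_cyclotomeTower_of_tateTwist` (a `CyclotomeTower l E` over EVERY cofinal chain
`E ∋ 1`, via abc-iut-w4-d024's `CyclotomeTower.ofAllLevels`).  Construction: fix a COMPATIBLE generator
`ξ = (ξ_N)_N` of `Λ(ℚ̄_pˣ)` (`cyclotome.exists_generator`, classical); `Ẑ` is torsion-free and `Δ_Θ` is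
commutative, so `y ↦ y^l : Δ_Θ ⥲ l·Δ_Θ` is a group isomorphism with inverse `r`; put
`red_N(x) := ξ_N ^ (level_N (e (r x)))`.  Onto (`ξ_N` primitive, `e` onto); kernel = the `N`-th powers in
`l·Δ_Θ` (`ZHatLevel.level_eq_one_iff_exists_pow`); continuous (its kernel contains the open
`(e ∘ incl)⁻¹ Ker(level_{lN})`); `G_K`-equivariant (`hequiv` + `ZHatLevel.toAdd_level_aut` + `hχ`);
compatible in `N` (`ξ_{M'}^{M'/M} = ξ_M`, `ZHatLevel.cast_level_mul`).

WHAT THIS CLOSES: G-L2t10-1 MODULO the Tate-twist datum — every `[EtTh]`-§2-at-the-model theorem binding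
`τ : D.CyclotomeTower l E` / `μ : D.CyclotomeMod l N` (TowerOfSetting `thetaEnvTower`, Sec2Cor218ivAllLevels,
Sec2ModelCor219*, IUT/HodgeArakelov `EtaleLevels.modelSystem`, …) becomes inhabited at any `ThetaSetting`
carrying the datum, e.g. the χ-twisted model of R78 (F5); at the root models `ThetaSetting.model p` /
`model₂ p` (trivial Galois action on `Δ_Θ`) NO such datum exists (abc-iut-w5-d125's non-triviality of the
cyclotomic character, `RootsOfUnityGaloisNontrivial.galMuN_ne_one`).  HONEST FRAMING: [EtTh] is a refereed
paper; nothing here asserts anything about an actual curve; no side is taken on [IUTchIII] Cor. 3.12;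
typed ≠ endorsed.
-/

noncomputable section

namespace Literature.AnabelianGeometry.EtaleTheta

open Literature.AnabelianGeometry.SemiGraphs
open CategoryTheory ProfiniteGrp ProfiniteGrp.ProfiniteCompletion

namespace ThetaSetting

variable {p : ℕ} [Fact p.Prime] (D : ThetaSetting p) {l : ℕ}

/-! ### `Δ_Θ` under an injective homomorphism to `Ẑ`: unique `l`-th roots -/

/-- `Δ_Θ` is commutative (field `ker_thetaToEll_comm` of the setting), as a `Commute` statement on the
subtype. [cite: MochizukiEtTh2009, §1 p.12] -/
theorem DeltaTheta.commute (y y' : ↥D.DeltaTheta) : Commute y y' :=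
  commute_iff_eq _ _ |>.2 (Subtype.ext (D.ker_thetaToEll_comm y y.2 y' y'.2))

variable {D}

/-- If `Δ_Θ` embeds in `Ẑ` (torsion-free) then `l`-th powers are INJECTIVE on `Δ_Θ` (`l ≥ 1`).
[cite: MochizukiEtTh2009, §1 p.12] -/
theorem DeltaTheta.pow_injective_of_injective (hl : 0 < l)
    (e : ↥D.DeltaTheta →* completion (GrpCat.of (Multiplicative ℤ))) (hinj : Function.Injective e)
    {y y' : ↥D.DeltaTheta} (h : y ^ l = y' ^ l) : y = y' := by
  have hc : Commute y y'⁻¹ := (DeltaTheta.commute D y y').inv_right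
  have h1 : (y * y'⁻¹) ^ l = 1 := by
    rw [hc.mul_pow, inv_pow, h, mul_inv_cancel]
  have h2 : e (y * y'⁻¹) = 1 :=
    AbsoluteAnabelian.ZHatCompletion.eq_one_of_pow_eq_one hl.ne' (by rw [← map_pow, h1, map_one])
  have h3 : y * y'⁻¹ = 1 := hinj (by rw [h2, map_one])
  exact mul_inv_eq_one.mp h3

/-- **The `l`-th root homomorphism `r : l·Δ_Θ → Δ_Θ`** (inverse of `y ↦ y^l`), for `Δ_Θ` embedded in `Ẑ`:
`(r x)^l = x`, `r (y^l) = y`, and `r` commutes with conjugation by `Π^tp_X`.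
[cite: MochizukiEtTh2009, Prop 2.12 (i) p.45] -/
theorem exists_lthRoot_hom_of_injective (hl : 0 < l)
    (e : ↥D.DeltaTheta →* completion (GrpCat.of (Multiplicative ℤ))) (hinj : Function.Injective e) :
    ∃ r : ↥(D.lDeltaTheta l) →* ↥D.DeltaTheta,
      (∀ x : ↥(D.lDeltaTheta l), ((r x : D.GtpTheta) ^ l) = x) ∧
      (∀ y : ↥D.DeltaTheta, r ⟨(y : D.GtpTheta) ^ l, y, y.2, rfl⟩ = y) ∧
      (∀ (g : D.PiTemp) (x : ↥(D.lDeltaTheta l)),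
        r ⟨D.toTheta g * x * (D.toTheta g)⁻¹, (D.lDeltaTheta_normal l).conj_mem _ x.2 _⟩ =
          MulAut.conjNormal (D.toTheta g) (r x)) := by
  classical
  -- the root function and its specification
  let rf : ↥(D.lDeltaTheta l) → ↥D.DeltaTheta := fun x => ⟨x.2.choose, x.2.choose_spec.1⟩
  have hrf : ∀ x : ↥(D.lDeltaTheta l), ((rf x : D.GtpTheta) ^ l) = x := fun x => x.2.choose_spec.2
  -- uniqueness of `l`-th roots in `Δ_Θ`
  have huniq : ∀ (x : ↥(D.lDeltaTheta l)) (y : ↥D.DeltaTheta), ((y : D.GtpTheta) ^ l) = x → rf x = y := by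
    intro x y hy
    apply DeltaTheta.pow_injective_of_injective hl e hinj
    apply Subtype.ext
    rw [SubmonoidClass.coe_pow, SubmonoidClass.coe_pow, hrf x, hy]
  have hone : rf 1 = 1 := huniq 1 1 (by rw [OneMemClass.coe_one, one_pow, OneMemClass.coe_one])
  have hmul : ∀ x x', rf (x * x') = rf x * rf x' := by
    intro x x'
    apply huniq
    have hc : Commute (rf x : D.GtpTheta) (rf x' : D.GtpTheta) :=
      commute_iff_eq _ _ |>.2 (D.ker_thetaToEll_comm _ (rf x).2 _ (rf x').2)
    rw [Subgroup.coe_mul, Subgroup.coe_mul, hc.mul_pow, hrf, hrf]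
  let r : ↥(D.lDeltaTheta l) →* ↥D.DeltaTheta := { toFun := rf, map_one' := hone, map_mul' := hmul }
  have hr : ∀ x, r x = rf x := fun _ => rfl
  refine ⟨r, fun x => by rw [hr]; exact hrf x, fun y => ?_, fun g x => ?_⟩
  · rw [hr]; exact huniq _ y rfl
  · rw [hr, hr]
    apply huniq
    rw [MulAut.conjNormal_apply, conj_pow, hrf]

/-! ### The level-`N` root character `Ẑ → μ_N` attached to a root of unity -/

/-- For `ζ ∈ μ_N(ℚ̄_p)`: the map `z ↦ ζ ^ (level_N z)` is a homomorphism `Ẑ → μ_N` — existence with its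
defining formula. [cite: MochizukiEtTh2009, Def 2.10 p.44] -/
theorem exists_rootChar (N : ℕ+) (ζ : MuN p N) :
    ∃ ρ : completion (GrpCat.of (Multiplicative ℤ)) →* MuN p N,
      ∀ z, ρ z = ζ ^ (Multiplicative.toAdd (ZHatLevel.level N z)).val := by
  have hζN : ζ ^ (N : ℕ) = 1 := by
    apply Subtype.ext
    rw [SubmonoidClass.coe_pow, OneMemClass.coe_one]
    exact (mem_rootsOfUnity _ _).1 ζ.2
  refine ⟨{ toFun := fun z => ζ ^ (Multiplicative.toAdd (ZHatLevel.level N z)).val,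
            map_one' := by simp only [map_one, toAdd_one, ZMod.val_zero, pow_zero],
            map_mul' := fun z z' => ?_ }, fun z => rfl⟩
  simp only [map_mul, toAdd_mul, ← pow_add]
  refine cyclotome.pow_val_eq_pow_of_mod_eq hζN ?_
  rw [ZMod.val_add, Nat.mod_mod]

/-! ### The construction -/

section TateTwist

variable (D)

/-- **`μ_N ≅ (l·Δ_Θ) ⊗ ℤ/Nℤ` at EVERY level, compatibly, from a Tate-twist datum `Δ_Θ ≅ Ẑ(χ)`.**  For a
continuous bijective `e : Δ_Θ → Ẑ` intertwining conjugation by `Π^tp_X` with the cyclotomic character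
`χ ∘ aug` (and `χ` acting on `μ_N(ℚ̄_p)` as the Galois action does), there is a family of identifications
`mods N : CyclotomeMod l N` (`N ≥ 1`) — continuous `G_K`-equivariant surjections `(l·Δ_Θ) ↠ μ_N` with kernel
the `N`-th powers — compatible with every power map `μ_{M'} ↠ μ_M`, `M ∣ M'` («the natural isomorphism
`μ_N ≅ (l·Δ_Θ) ⊗ (ℤ/Nℤ)`», p. 46; «`M_{N'}` … induced by `M`», Def. 2.13 (ii)).
[cite: MochizukiEtTh2009, Def 2.13 (ii) p.48] -/
theorem exists_cyclotomeMod_family_of_tateTwist (hl : 0 < l)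
    (e : ↥D.DeltaTheta →* completion (GrpCat.of (Multiplicative ℤ))) (he : Continuous e)
    (hbij : Function.Bijective e)
    (χ : GQp p →* MulAut (completion (GrpCat.of (Multiplicative ℤ))))
    (hχ : ∀ (σ : GQp p) (N : ℕ+) (ζ : MuN p N), galMuN p N σ ζ = ζ ^ (ZHatLevel.levelChar N (χ σ)).val)
    (hequiv : ∀ (g : D.PiTemp) (d : ↥D.DeltaTheta),
      e (MulAut.conjNormal (D.toTheta g) d) = χ (D.aug.toMonoidHom g) (e d)) :
    ∃ mods : ∀ N : ℕ+, D.CyclotomeMod l N,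
      ∀ (M M' : ℕ+) (h : (M : ℕ) ∣ (M' : ℕ)) (x : ↥(D.lDeltaTheta l)),
        MuN.red p M M' h ((mods M').red x) = (mods M).red x := by
  classical
  -- a compatible generator of the roots of unity of `ℚ̄_p`
  haveI : CharZero (PadicAlgCl p) :=
    charZero_of_injective_algebraMap (algebraMap ℚ_[p] (PadicAlgCl p)).injective
  obtain ⟨ξ, hξ⟩ := cyclotome.exists_generator (R := PadicAlgCl p)
    (cyclotome.exists_isPrimitiveRoot_of_isSepClosed (PadicAlgCl p))
  let ζ : ∀ N : ℕ+, MuN p N := fun N =>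
    ⟨(ξ : ℕ+ → (PadicAlgCl p)ˣ) N, (mem_rootsOfUnity _ _).2 (cyclotome.pow_eq_one ξ N)⟩
  have hζcoe : ∀ N : ℕ+, ((ζ N : MuN p N) : (PadicAlgCl p)ˣ) = (ξ : ℕ+ → (PadicAlgCl p)ˣ) N := fun N => rfl
  have hζprim : ∀ N : ℕ+, IsPrimitiveRoot (ζ N) (N : ℕ) := fun N =>
    IsPrimitiveRoot.coe_submonoidClass_iff.1 (by rw [hζcoe]; exact hξ N)
  have hζN : ∀ N : ℕ+, (ζ N) ^ (N : ℕ) = 1 := fun N => (hζprim N).pow_eq_one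
  -- the `l`-th root homomorphism and the root characters
  obtain ⟨r, hrpow, hrroot, hrconj⟩ := exists_lthRoot_hom_of_injective hl e hbij.1
  choose ρ hρ using fun N : ℕ+ => exists_rootChar (p := p) N (ζ N)
  -- the identification at level `N`
  let red : ∀ N : ℕ+, ↥(D.lDeltaTheta l) →* MuN p N := fun N => (ρ N).comp (e.comp r)
  have hred : ∀ (N : ℕ+) (x : ↥(D.lDeltaTheta l)),
      red N x = ζ N ^ (Multiplicative.toAdd (ZHatLevel.level N (e (r x)))).val := fun N x => hρ N _
  -- `x = (r x)^l` inside `Δ_Θ`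
  have hxr : ∀ x : ↥(D.lDeltaTheta l),
      (⟨(x : D.GtpTheta), D.lDeltaTheta_le l x.2⟩ : ↥D.DeltaTheta) = r x ^ l := fun x =>
    Subtype.ext (by rw [SubmonoidClass.coe_pow, hrpow])
  -- kernel at level `N`: `level_N (e (r x)) = 1`
  have hker : ∀ (N : ℕ+) (x : ↥(D.lDeltaTheta l)), red N x = 1 ↔ ZHatLevel.level N (e (r x)) = 1 := by
    intro N x
    rw [hred, (hζprim N).pow_eq_one_iff_dvd]
    constructor
    · intro h
      have h0 : (Multiplicative.toAdd (ZHatLevel.level N (e (r x)))).val = 0 :=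
        Nat.eq_zero_of_dvd_of_lt h (ZMod.val_lt _)
      rw [ZMod.val_eq_zero] at h0
      rw [← ofAdd_toAdd (ZHatLevel.level N (e (r x))), h0, ofAdd_zero]
    · intro h
      rw [h, toAdd_one, ZMod.val_zero]
      exact dvd_zero _
  -- onto: `ζ_N` is primitive and `e ∘ r` is onto
  have hsurj : ∀ N : ℕ+, Function.Surjective (red N) := by
    intro N m
    haveI : NeZero ((N : ℕ+) : ℕ) := NeZero.of_pos N.pos
    obtain ⟨i, hi, hiu⟩ := (hξ N).eq_pow_of_mem_rootsOfUnity m.2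
    have him : ζ N ^ i = m := Subtype.ext (by rw [SubmonoidClass.coe_pow, hζcoe]; exact hiu)
    obtain ⟨y, hy⟩ := hbij.2 (ZHatLevel.eta i)
    refine ⟨⟨(y : D.GtpTheta) ^ l, y, y.2, rfl⟩, ?_⟩
    rw [hred, hrroot, hy, ZHatLevel.level_eta, toAdd_ofAdd, Int.cast_natCast, ZMod.val_natCast,
      Nat.mod_eq_of_lt hi, him]
  -- kernel = the `N`-th powers in `l·Δ_Θ`
  have hkerN : ∀ (N : ℕ+) (x : ↥(D.lDeltaTheta l)),
      red N x = 1 ↔ ∃ y : ↥(D.lDeltaTheta l), x = y ^ (N : ℕ) := by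
    intro N x
    rw [hker, ZHatLevel.level_eq_one_iff_exists_pow]
    constructor
    · rintro ⟨w, hw⟩
      obtain ⟨y', hy'⟩ := hbij.2 w
      have hyN : y' ^ (N : ℕ) = r x := hbij.1 (by rw [map_pow, hy', hw])
      refine ⟨⟨(y' : D.GtpTheta) ^ l, y', y'.2, rfl⟩, Subtype.ext ?_⟩
      show (x : D.GtpTheta) = ((y' : D.GtpTheta) ^ l) ^ (N : ℕ)
      rw [pow_right_comm, ← SubmonoidClass.coe_pow, hyN, hrpow]
    · rintro ⟨y, rfl⟩
      refine ⟨e (r y), ?_⟩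
      rw [← map_pow, ← map_pow]
  -- continuity: the kernel contains the open `(e ∘ incl)⁻¹ Ker(level_{lN})`
  have hcont : ∀ N : ℕ+, Continuous (red N) := by
    intro N
    have hincl : Continuous fun x : ↥(D.lDeltaTheta l) =>
        e ⟨(x : D.GtpTheta), D.lDeltaTheta_le l x.2⟩ :=
      he.comp (Continuous.subtype_mk continuous_subtype_val _)
    have hlN : ∀ x : ↥(D.lDeltaTheta l),
        ZHatLevel.level (⟨l, hl⟩ * N) (e ⟨(x : D.GtpTheta), D.lDeltaTheta_le l x.2⟩) = 1 →
          red N x = 1 := by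
      intro x hx
      rw [hker, ZHatLevel.level_eq_one_iff_exists_pow]
      rw [ZHatLevel.level_eq_one_iff_exists_pow] at hx
      obtain ⟨w, hw⟩ := hx
      obtain ⟨v, rfl⟩ := hbij.2 w
      refine ⟨e v, ?_⟩
      -- `(v^N)^l = (r x)^l` in `Δ_Θ`, and `l`-th powers are injective there
      have h1 : (v ^ (N : ℕ)) ^ l = r x ^ l := by
        apply hbij.1
        rw [← hxr, ← hw, ← pow_mul, ← map_pow, PNat.mul_coe, PNat.mk_coe, Nat.mul_comm]
      rw [← map_pow, DeltaTheta.pow_injective_of_injective hl e hbij.1 h1]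
    have hopen : IsOpen ((fun x : ↥(D.lDeltaTheta l) => e ⟨(x : D.GtpTheta), D.lDeltaTheta_le l x.2⟩) ⁻¹'
        ((ZHatLevel.level (⟨l, hl⟩ * N)).ker : Set (completion (GrpCat.of (Multiplicative ℤ))))) :=
      (ZHatLevel.isOpen_ker_level _).preimage hincl
    have hmem : (1 : ↥(D.lDeltaTheta l)) ∈
        (fun x : ↥(D.lDeltaTheta l) => e ⟨(x : D.GtpTheta), D.lDeltaTheta_le l x.2⟩) ⁻¹'
          ((ZHatLevel.level (⟨l, hl⟩ * N)).ker : Set (completion (GrpCat.of (Multiplicative ℤ)))) := by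
      rw [Set.mem_preimage, SetLike.mem_coe, MonoidHom.mem_ker, hxr, map_one, one_pow, map_one, map_one]
    have hev : ∀ᶠ x in nhds (1 : ↥(D.lDeltaTheta l)), red N x = red N 1 := by
      rw [map_one]
      filter_upwards [hopen.mem_nhds hmem] with x hx
      rw [Set.mem_preimage, SetLike.mem_coe, MonoidHom.mem_ker] at hx
      exact hlN x hx
    exact continuous_of_continuousAt_one (red N) ((Filter.tendsto_pure.2 hev).mono_right (pure_le_nhds _))
  -- `G_K`-equivariance
  have hconj : ∀ (N : ℕ+) (σ : D.PiTemp) (x : ↥(D.lDeltaTheta l)),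
      red N ⟨D.toTheta σ * x * (D.toTheta σ)⁻¹, (D.lDeltaTheta_normal l).conj_mem _ x.2 _⟩ =
        galMuN p N (D.aug.toMonoidHom σ) (red N x) := by
    intro N σ x
    rw [hred, hred, hrconj, hequiv, map_pow, hχ, ← pow_mul]
    refine cyclotome.pow_val_eq_pow_of_mod_eq (hζN N) ?_
    rw [ZHatLevel.toAdd_level_aut, ZMod.val_mul, Nat.mod_mod]
  -- compatibility with the power maps `μ_{M'} ↠ μ_M`
  have hcompat : ∀ (M M' : ℕ+) (h : (M : ℕ) ∣ (M' : ℕ)) (x : ↥(D.lDeltaTheta l)),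
      MuN.red p M M' h (red M' x) = red M x := by
    intro M M' h x
    obtain ⟨d₀, hd₀⟩ := id h
    have hd₀pos : 0 < d₀ := Nat.pos_of_ne_zero (by rintro rfl; simp at hd₀)
    obtain ⟨d, rfl⟩ : ∃ d : ℕ+, M' = M * d :=
      ⟨⟨d₀, hd₀pos⟩, PNat.eq (by rw [PNat.mul_coe, PNat.mk_coe, hd₀])⟩
    haveI : NeZero ((M * d : ℕ+) : ℕ) := NeZero.of_pos (M * d).pos
    have hq : ((M * d : ℕ+) : ℕ) / (M : ℕ) = d := by rw [PNat.mul_coe, Nat.mul_div_cancel_left _ M.pos]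
    apply Subtype.ext
    rw [MuN.coe_red, hred, hred, SubmonoidClass.coe_pow, SubmonoidClass.coe_pow, hζcoe, hζcoe,
      pow_right_comm, hq, cyclotome.pow_apply_mul]
    refine cyclotome.pow_val_eq_pow_of_mod_eq (hξ M).pow_eq_one ?_
    -- `level_{M d} ≡ level_M (mod M)`
    have hc := ZHatLevel.cast_level_mul M d (e (r x))
    rw [ZMod.castHom_apply, ZMod.cast_eq_val] at hc
    have hc' := congrArg ZMod.val hc
    rw [ZMod.val_natCast] at hc'
    exact hc'.trans (Nat.mod_eq_of_lt (ZMod.val_lt _)).symm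
  exact ⟨fun N => ⟨red N, hsurj N, hkerN N, hcont N, hconj N⟩, hcompat⟩

/-- **`CyclotomeMod l N` is inhabited at every level** given a Tate-twist datum on `Δ_Θ`.
[cite: MochizukiEtTh2009, Def 2.13 p.46] -/
theorem nonempty_cyclotomeMod_of_tateTwist (hl : 0 < l)
    (e : ↥D.DeltaTheta →* completion (GrpCat.of (Multiplicative ℤ))) (he : Continuous e)
    (hbij : Function.Bijective e)
    (χ : GQp p →* MulAut (completion (GrpCat.of (Multiplicative ℤ))))
    (hχ : ∀ (σ : GQp p) (N : ℕ+) (ζ : MuN p N), galMuN p N σ ζ = ζ ^ (ZHatLevel.levelChar N (χ σ)).val)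
    (hequiv : ∀ (g : D.PiTemp) (d : ↥D.DeltaTheta),
      e (MulAut.conjNormal (D.toTheta g) d) = χ (D.aug.toMonoidHom g) (e d))
    (N : ℕ+) : Nonempty (D.CyclotomeMod l N) := by
  obtain ⟨mods, -⟩ := D.exists_cyclotomeMod_family_of_tateTwist hl e he hbij χ hχ hequiv
  exact ⟨mods N⟩

/-- **A `CyclotomeTower l E` exists over EVERY cofinal chain `E ∋ 1`** given a Tate-twist datum on `Δ_Θ`
(GAP-LEDGER G-L2t10-1 modulo the datum). [cite: MochizukiEtTh2009, Cor 2.19 (ii) p.64] -/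
theorem nonempty_cyclotomeTower_of_tateTwist (hl : 0 < l)
    (e : ↥D.DeltaTheta →* completion (GrpCat.of (Multiplicative ℤ))) (he : Continuous e)
    (hbij : Function.Bijective e)
    (χ : GQp p →* MulAut (completion (GrpCat.of (Multiplicative ℤ))))
    (hχ : ∀ (σ : GQp p) (N : ℕ+) (ζ : MuN p N), galMuN p N σ ζ = ζ ^ (ZHatLevel.levelChar N (χ σ)).val)
    (hequiv : ∀ (g : D.PiTemp) (d : ↥D.DeltaTheta),
      e (MulAut.conjNormal (D.toTheta g) d) = χ (D.aug.toMonoidHom g) (e d))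
    {E : Set ℕ+} (one_mem : (1 : ℕ+) ∈ E) (cofinal : ∀ n : ℕ+, ∃ M ∈ E, n ∣ M)
    (total : ∀ M ∈ E, ∀ M' ∈ E, M ∣ M' ∨ M' ∣ M) : Nonempty (D.CyclotomeTower l E) := by
  obtain ⟨mods, hmods⟩ := D.exists_cyclotomeMod_family_of_tateTwist hl e he hbij χ hχ hequiv
  exact ⟨CyclotomeTower.ofAllLevels mods hmods one_mem cofinal total⟩

end TateTwist

/-! ### The inverse parametrisation `Ẑ → Δ_Θ` (the shape of abc-iut-L6-d6's `c^t`-coordinates) -/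

section TateTwistInv

/-- From a continuous bijective homomorphism `f : Ẑ → Δ_Θ` (e.g. `t ↦ c^t` on the theta centre,
`SettingModelThetaCentreZHat.lean`) with `Δ_Θ` Hausdorff: its inverse `e : Δ_Θ → Ẑ` is a continuous
bijective homomorphism (`Ẑ` is compact). [cite: RibesZalesskii2010, Thm 2.7.1] -/
theorem exists_inverse_of_zHat_hom [T2Space ↥D.DeltaTheta]
    (f : completion (GrpCat.of (Multiplicative ℤ)) →* ↥D.DeltaTheta) (hf : Continuous f)
    (hbij : Function.Bijective f) :
    ∃ e : ↥D.DeltaTheta →* completion (GrpCat.of (Multiplicative ℤ)),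
      Continuous e ∧ Function.Bijective e ∧ (∀ t, e (f t) = t) ∧ (∀ d, f (e d) = d) := by
  let E : completion (GrpCat.of (Multiplicative ℤ)) ≃* ↥D.DeltaTheta := MulEquiv.ofBijective f hbij
  have hE : Continuous (E : completion (GrpCat.of (Multiplicative ℤ)) → ↥D.DeltaTheta) := hf
  let H : completion (GrpCat.of (Multiplicative ℤ)) ≃ₜ ↥D.DeltaTheta := hE.homeoOfEquivCompactToT2 (f := E.toEquiv)
  refine ⟨E.symm.toMonoidHom, ?_, E.symm.bijective, fun t => E.symm_apply_apply t, fun d => E.apply_symm_apply d⟩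
  exact H.symm.continuous

variable (D)

/-- **`μ_N ≅ (l·Δ_Θ) ⊗ ℤ/Nℤ` at every level, compatibly, from the INVERSE parametrisation `f : Ẑ ⥲ Δ_Θ`**
(continuous bijective homomorphism, `Δ_Θ` Hausdorff) intertwining `χ ∘ aug` with conjugation:
`g · f(t) · g⁻¹ = f(χ(aug g) · t)` — the shape in which the R78 models coordinatise the theta centre
(`θ_φ(c^t) ≡ c^{φ t}`). [cite: MochizukiEtTh2009, Def 2.13 (ii) p.48] -/
theorem exists_cyclotomeMod_family_of_tateTwist_inv [T2Space ↥D.DeltaTheta] (hl : 0 < l)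
    (f : completion (GrpCat.of (Multiplicative ℤ)) →* ↥D.DeltaTheta) (hf : Continuous f)
    (hbij : Function.Bijective f)
    (χ : GQp p →* MulAut (completion (GrpCat.of (Multiplicative ℤ))))
    (hχ : ∀ (σ : GQp p) (N : ℕ+) (ζ : MuN p N), galMuN p N σ ζ = ζ ^ (ZHatLevel.levelChar N (χ σ)).val)
    (hequiv : ∀ (g : D.PiTemp) (t : completion (GrpCat.of (Multiplicative ℤ))),
      MulAut.conjNormal (D.toTheta g) (f t) = f (χ (D.aug.toMonoidHom g) t)) :
    ∃ mods : ∀ N : ℕ+, D.CyclotomeMod l N,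
      ∀ (M M' : ℕ+) (h : (M : ℕ) ∣ (M' : ℕ)) (x : ↥(D.lDeltaTheta l)),
        MuN.red p M M' h ((mods M').red x) = (mods M).red x := by
  obtain ⟨e, he, hebij, hef, hfe⟩ := exists_inverse_of_zHat_hom f hf hbij
  refine D.exists_cyclotomeMod_family_of_tateTwist hl e he hebij χ hχ fun g d => ?_
  conv_lhs => rw [← hfe d]
  rw [hequiv, hef]

/-- **A `CyclotomeTower l E` over every cofinal chain `E ∋ 1`** from the inverse parametrisation
`f : Ẑ ⥲ Δ_Θ` (GAP-LEDGER G-L2t10-1 modulo that datum). [cite: MochizukiEtTh2009, Cor 2.19 (ii) p.64] -/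
theorem nonempty_cyclotomeTower_of_tateTwist_inv [T2Space ↥D.DeltaTheta] (hl : 0 < l)
    (f : completion (GrpCat.of (Multiplicative ℤ)) →* ↥D.DeltaTheta) (hf : Continuous f)
    (hbij : Function.Bijective f)
    (χ : GQp p →* MulAut (completion (GrpCat.of (Multiplicative ℤ))))
    (hχ : ∀ (σ : GQp p) (N : ℕ+) (ζ : MuN p N), galMuN p N σ ζ = ζ ^ (ZHatLevel.levelChar N (χ σ)).val)
    (hequiv : ∀ (g : D.PiTemp) (t : completion (GrpCat.of (Multiplicative ℤ))),
      MulAut.conjNormal (D.toTheta g) (f t) = f (χ (D.aug.toMonoidHom g) t))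
    {E : Set ℕ+} (one_mem : (1 : ℕ+) ∈ E) (cofinal : ∀ n : ℕ+, ∃ M ∈ E, n ∣ M)
    (total : ∀ M ∈ E, ∀ M' ∈ E, M ∣ M' ∨ M' ∣ M) : Nonempty (D.CyclotomeTower l E) := by
  obtain ⟨mods, hmods⟩ := D.exists_cyclotomeMod_family_of_tateTwist_inv hl f hf hbij χ hχ hequiv
  exact ⟨CyclotomeTower.ofAllLevels mods hmods one_mem cofinal total⟩

end TateTwistInv

end ThetaSetting

end Literature.AnabelianGeometry.EtaleTheta

end
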